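import Summits.CriticalPhenomena.PercolationContinuityZ3.Theorems.Transplant.FKConnectivityAllQPat3CutOne
import Summits.CriticalPhenomena.PercolationContinuityZ3.Theorems.Transplant.FKConnectivityAllQPat3FastCheck
import HarnessLib

/-!
# Connectivity correlation inequalities for `φ_{w,q}`, every `q > 0` — THEOREM 3C DATA, the 1-CUT reduction for `starSTab`
# (2 products, denominator 2; hypothesis form)

Theorems + data file (`--supports stmt-CriticalPhenomena-4575`), census lane `prim-bschramm-census` (gen 36) of the post-continuity programme (LANE 2 bschramm, FK sub-lane);
builds on p205010 (kernel theorem, internal audit signed; external expert review pending).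
No named facts, no sorries; standard axioms (`decide +kernel` only).  Census g32 §4's `c1` certificate for the target `starSTab`
re-derived by LP (`code/lp/cut1.py`) and checked in 25 pair declarations; **`FK.cut1StarS_level_nonneg`** concludes
`0 ≤ 2 · lev2 (A ∪ B) x y s starSTab λ` from the levelwise validity of the listed members on `A` (the induction hypothesis of
THEOREM 3C) via `FK.cut1_level_nonneg_of_symCert`.
[cite: AyyerLinussonRavichandran2025, §7 eq. (13)–(15) (p. 22)] [cite: Grimmett2006, §3.8 (pp. 61–62)]
-/

noncomputable section

namespace Summit.CriticalPhenomena.PercolationContinuityZ3.Theorems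

namespace FK

open SimpleGraph Literature.Probability.LatticeModels Literature.Probability.Percolation

section Data

/- Sequential elaboration of the kernel evaluations (memory on the smaller farm nodes). -/
set_option Elab.async false

open scoped Classical

variable {V : Type*} [Fintype V]

/-- The 2 products of the 1-CUT certificate for the target `starSTab` (denominator `2`, shifts `≤ 0`; generators on the
3-mark side among the `famT12` tables / flip-orbit indicators, on the 2-mark side the bit indicators, `one2` on the empty piece),
found by census g36's LP `code/lp/cut1.py`. [folklore] -/
def prodsCut1StarS : List Prod3 :=
  [
  ⟨2, 0, starSTab, (bitTab true true), one2⟩,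
  ⟨1, 0, starSTab, bitMix, one2⟩]

/-- The symmetrised target function (1-CUT join, third pair ignored). [folklore] -/
abbrev tauCut1StarS : ℕ → Pat3 → Pat3 → Pat3 → Pat3 → Pat3 → Pat3 → ℤ := target3SymF joinR3 corrR3 starSTab

/-- The shifts are at most `0`. [folklore] -/
theorem cut1StarS_shift : (prodsCut1StarS.all fun p => decide (p.shift ≤ 0)) = true := by decide +kernel

/-- Pair `(all, all)` of the Cut1StarS certificate check (kernel evaluation). [folklore] -/
theorem cut1StarS_pair_all_all : loop1G tauCut1StarS 8 2 0 (prodsCut1StarS.filter fun p => suppAt p.gK Pat3.all Pat3.all) Pat3.all Pat3.all = true := by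
  decide +kernel

/-- Pair `(all, xy_s)` of the Cut1StarS certificate check (kernel evaluation). [folklore] -/
theorem cut1StarS_pair_all_xy_s : loop1G tauCut1StarS 8 2 0 (prodsCut1StarS.filter fun p => suppAt p.gK Pat3.all Pat3.xy_s) Pat3.all Pat3.xy_s = true := by
  decide +kernel

/-- Pair `(all, xs_y)` of the Cut1StarS certificate check (kernel evaluation). [folklore] -/
theorem cut1StarS_pair_all_xs_y : loop1G tauCut1StarS 8 2 0 (prodsCut1StarS.filter fun p => suppAt p.gK Pat3.all Pat3.xs_y) Pat3.all Pat3.xs_y = true := by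
  decide +kernel

/-- Pair `(all, ys_x)` of the Cut1StarS certificate check (kernel evaluation). [folklore] -/
theorem cut1StarS_pair_all_ys_x : loop1G tauCut1StarS 8 2 0 (prodsCut1StarS.filter fun p => suppAt p.gK Pat3.all Pat3.ys_x) Pat3.all Pat3.ys_x = true := by
  decide +kernel

/-- Pair `(all, sep)` of the Cut1StarS certificate check (kernel evaluation). [folklore] -/
theorem cut1StarS_pair_all_sep : loop1G tauCut1StarS 8 2 0 (prodsCut1StarS.filter fun p => suppAt p.gK Pat3.all Pat3.sep) Pat3.all Pat3.sep = true := by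
  decide +kernel

/-- Pair `(xy_s, all)` of the Cut1StarS certificate check (kernel evaluation). [folklore] -/
theorem cut1StarS_pair_xy_s_all : loop1G tauCut1StarS 8 2 0 (prodsCut1StarS.filter fun p => suppAt p.gK Pat3.xy_s Pat3.all) Pat3.xy_s Pat3.all = true := by
  decide +kernel

/-- Pair `(xy_s, xy_s)` of the Cut1StarS certificate check (kernel evaluation). [folklore] -/
theorem cut1StarS_pair_xy_s_xy_s : loop1G tauCut1StarS 8 2 0 (prodsCut1StarS.filter fun p => suppAt p.gK Pat3.xy_s Pat3.xy_s) Pat3.xy_s Pat3.xy_s = true := by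
  decide +kernel

/-- Pair `(xy_s, xs_y)` of the Cut1StarS certificate check (kernel evaluation). [folklore] -/
theorem cut1StarS_pair_xy_s_xs_y : loop1G tauCut1StarS 8 2 0 (prodsCut1StarS.filter fun p => suppAt p.gK Pat3.xy_s Pat3.xs_y) Pat3.xy_s Pat3.xs_y = true := by
  decide +kernel

/-- Pair `(xy_s, ys_x)` of the Cut1StarS certificate check (kernel evaluation). [folklore] -/
theorem cut1StarS_pair_xy_s_ys_x : loop1G tauCut1StarS 8 2 0 (prodsCut1StarS.filter fun p => suppAt p.gK Pat3.xy_s Pat3.ys_x) Pat3.xy_s Pat3.ys_x = true := by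
  decide +kernel

/-- Pair `(xy_s, sep)` of the Cut1StarS certificate check (kernel evaluation). [folklore] -/
theorem cut1StarS_pair_xy_s_sep : loop1G tauCut1StarS 8 2 0 (prodsCut1StarS.filter fun p => suppAt p.gK Pat3.xy_s Pat3.sep) Pat3.xy_s Pat3.sep = true := by
  decide +kernel

/-- Pair `(xs_y, all)` of the Cut1StarS certificate check (kernel evaluation). [folklore] -/
theorem cut1StarS_pair_xs_y_all : loop1G tauCut1StarS 8 2 0 (prodsCut1StarS.filter fun p => suppAt p.gK Pat3.xs_y Pat3.all) Pat3.xs_y Pat3.all = true := by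
  decide +kernel

/-- Pair `(xs_y, xy_s)` of the Cut1StarS certificate check (kernel evaluation). [folklore] -/
theorem cut1StarS_pair_xs_y_xy_s : loop1G tauCut1StarS 8 2 0 (prodsCut1StarS.filter fun p => suppAt p.gK Pat3.xs_y Pat3.xy_s) Pat3.xs_y Pat3.xy_s = true := by
  decide +kernel

/-- Pair `(xs_y, xs_y)` of the Cut1StarS certificate check (kernel evaluation). [folklore] -/
theorem cut1StarS_pair_xs_y_xs_y : loop1G tauCut1StarS 8 2 0 (prodsCut1StarS.filter fun p => suppAt p.gK Pat3.xs_y Pat3.xs_y) Pat3.xs_y Pat3.xs_y = true := by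
  decide +kernel

/-- Pair `(xs_y, ys_x)` of the Cut1StarS certificate check (kernel evaluation). [folklore] -/
theorem cut1StarS_pair_xs_y_ys_x : loop1G tauCut1StarS 8 2 0 (prodsCut1StarS.filter fun p => suppAt p.gK Pat3.xs_y Pat3.ys_x) Pat3.xs_y Pat3.ys_x = true := by
  decide +kernel

/-- Pair `(xs_y, sep)` of the Cut1StarS certificate check (kernel evaluation). [folklore] -/
theorem cut1StarS_pair_xs_y_sep : loop1G tauCut1StarS 8 2 0 (prodsCut1StarS.filter fun p => suppAt p.gK Pat3.xs_y Pat3.sep) Pat3.xs_y Pat3.sep = true := by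
  decide +kernel

/-- Pair `(ys_x, all)` of the Cut1StarS certificate check (kernel evaluation). [folklore] -/
theorem cut1StarS_pair_ys_x_all : loop1G tauCut1StarS 8 2 0 (prodsCut1StarS.filter fun p => suppAt p.gK Pat3.ys_x Pat3.all) Pat3.ys_x Pat3.all = true := by
  decide +kernel

/-- Pair `(ys_x, xy_s)` of the Cut1StarS certificate check (kernel evaluation). [folklore] -/
theorem cut1StarS_pair_ys_x_xy_s : loop1G tauCut1StarS 8 2 0 (prodsCut1StarS.filter fun p => suppAt p.gK Pat3.ys_x Pat3.xy_s) Pat3.ys_x Pat3.xy_s = true := by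
  decide +kernel

/-- Pair `(ys_x, xs_y)` of the Cut1StarS certificate check (kernel evaluation). [folklore] -/
theorem cut1StarS_pair_ys_x_xs_y : loop1G tauCut1StarS 8 2 0 (prodsCut1StarS.filter fun p => suppAt p.gK Pat3.ys_x Pat3.xs_y) Pat3.ys_x Pat3.xs_y = true := by
  decide +kernel

/-- Pair `(ys_x, ys_x)` of the Cut1StarS certificate check (kernel evaluation). [folklore] -/
theorem cut1StarS_pair_ys_x_ys_x : loop1G tauCut1StarS 8 2 0 (prodsCut1StarS.filter fun p => suppAt p.gK Pat3.ys_x Pat3.ys_x) Pat3.ys_x Pat3.ys_x = true := by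
  decide +kernel

/-- Pair `(ys_x, sep)` of the Cut1StarS certificate check (kernel evaluation). [folklore] -/
theorem cut1StarS_pair_ys_x_sep : loop1G tauCut1StarS 8 2 0 (prodsCut1StarS.filter fun p => suppAt p.gK Pat3.ys_x Pat3.sep) Pat3.ys_x Pat3.sep = true := by
  decide +kernel

/-- Pair `(sep, all)` of the Cut1StarS certificate check (kernel evaluation). [folklore] -/
theorem cut1StarS_pair_sep_all : loop1G tauCut1StarS 8 2 0 (prodsCut1StarS.filter fun p => suppAt p.gK Pat3.sep Pat3.all) Pat3.sep Pat3.all = true := by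
  decide +kernel

/-- Pair `(sep, xy_s)` of the Cut1StarS certificate check (kernel evaluation). [folklore] -/
theorem cut1StarS_pair_sep_xy_s : loop1G tauCut1StarS 8 2 0 (prodsCut1StarS.filter fun p => suppAt p.gK Pat3.sep Pat3.xy_s) Pat3.sep Pat3.xy_s = true := by
  decide +kernel

/-- Pair `(sep, xs_y)` of the Cut1StarS certificate check (kernel evaluation). [folklore] -/
theorem cut1StarS_pair_sep_xs_y : loop1G tauCut1StarS 8 2 0 (prodsCut1StarS.filter fun p => suppAt p.gK Pat3.sep Pat3.xs_y) Pat3.sep Pat3.xs_y = true := by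
  decide +kernel

/-- Pair `(sep, ys_x)` of the Cut1StarS certificate check (kernel evaluation). [folklore] -/
theorem cut1StarS_pair_sep_ys_x : loop1G tauCut1StarS 8 2 0 (prodsCut1StarS.filter fun p => suppAt p.gK Pat3.sep Pat3.ys_x) Pat3.sep Pat3.ys_x = true := by
  decide +kernel

/-- Pair `(sep, sep)` of the Cut1StarS certificate check (kernel evaluation). [folklore] -/
theorem cut1StarS_pair_sep_sep : loop1G tauCut1StarS 8 2 0 (prodsCut1StarS.filter fun p => suppAt p.gK Pat3.sep Pat3.sep) Pat3.sep Pat3.sep = true := by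
  decide +kernel

/-- **The symmetrised certificate family.** [folklore] -/
theorem cut1StarS_cert (d : ℕ) (P1 Q1 P2 Q2 P3 Q3 : Pat3) :
    8 * ∑ j : Fin prodsCut1StarS.length, ((prodsCut1StarS.get j).lam : ℤ) * (prodsCut1StarS.get j).tensor d P1 Q1 P2 Q2 P3 Q3 ≤
      (2 : ℕ) * target3Sym joinR3 corrR3 starSTab d P1 Q1 P2 Q2 P3 Q3 :=
  symCert_of_pairs corrR3_le_two 2 0 cut1StarS_shift (fun PK QK => by
    cases PK <;> cases QK
    exacts [cut1StarS_pair_all_all, cut1StarS_pair_all_xy_s, cut1StarS_pair_all_xs_y, cut1StarS_pair_all_ys_x, cut1StarS_pair_all_sep,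
      cut1StarS_pair_xy_s_all, cut1StarS_pair_xy_s_xy_s, cut1StarS_pair_xy_s_xs_y, cut1StarS_pair_xy_s_ys_x, cut1StarS_pair_xy_s_sep,
      cut1StarS_pair_xs_y_all, cut1StarS_pair_xs_y_xy_s, cut1StarS_pair_xs_y_xs_y, cut1StarS_pair_xs_y_ys_x, cut1StarS_pair_xs_y_sep,
      cut1StarS_pair_ys_x_all, cut1StarS_pair_ys_x_xy_s, cut1StarS_pair_ys_x_xs_y, cut1StarS_pair_ys_x_ys_x, cut1StarS_pair_ys_x_sep,
      cut1StarS_pair_sep_all, cut1StarS_pair_sep_xy_s, cut1StarS_pair_sep_xs_y, cut1StarS_pair_sep_ys_x, cut1StarS_pair_sep_sep]) d P1 Q1 P2 Q2 P3 Q3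

/-- **THEOREM 3C's 1-CUT REDUCTION for the target `starSTab` (census g32 §4, kernel, hypothesis form):** if `G = A ∪ B` with `A, B`
edge-disjoint and meeting in the single unmarked vertex `w`, marks `x, s` on `A` and `y` on `B` (off `w`), and the listed members
are levelwise nonnegative on `A` read on `(x, w, s)`, then `0 ≤ 2 · lev2 G x y s starSTab λ` at every level `λ`.
[cite: AyyerLinussonRavichandran2025, §7 (p. 22)] -/
theorem cut1StarS_level_nonneg {E₁ E₂ : Finset (Sym2 V)} {V₁ V₂ : Set V} {w x y s : V}
    (hd : Disjoint E₁ E₂) (h₁ : ∀ e ∈ (↑E₁ : Set (Sym2 V)), ∀ z ∈ e, z ∈ V₁)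
    (h₂ : ∀ e ∈ (↑E₂ : Set (Sym2 V)), ∀ z ∈ e, z ∈ V₂) (hS : V₁ ∩ V₂ ⊆ ({w} : Set V)) (hxV : x ∉ V₂)
    (hsV : s ∉ V₂) (hyV : y ∉ V₁) (hxw : x ≠ w) (hyw : y ≠ w) (hxy : x ≠ y) (hsw : s ≠ w) (hsy : s ≠ y)
    (h_starSTab : ∀ μ : ℕ, 0 ≤ lev2 E₁ x w s starSTab μ)
    (lam : ℕ) : 0 ≤ ((2 : ℕ) : ℤ) * lev2 (E₁ ∪ E₂) x y s starSTab lam := by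
  refine cut1_level_nonneg_of_symCert hd h₁ h₂ hS hxV hsV hyV hxw hyw hxy hsw hsy starSTab 2 Finset.univ
    (fun j => prodsCut1StarS.get j) cut1StarS_cert (fun j _ μ => ?_) lam
  fin_cases j
  · exact ⟨h_starSTab μ, lev2_bitTab_nonneg true true E₂ w y y μ, lev2_one2_nonneg _ x w s μ⟩
  · exact ⟨h_starSTab μ, lev2_bitMix_nonneg E₂ w y y μ, lev2_one2_nonneg _ x w s μ⟩

end Data

end FK

end Summit.CriticalPhenomena.PercolationContinuityZ3.Theorems

end
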